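import Summits.QuantumFields.YangMills.Theorems.FlatTubeReductionDiagonalMomentSandwichCore
import Summits.QuantumFields.YangMills.Theorems.FemtoTransferGapSlabGround
import Literature.MathematicalPhysics.QuantumFieldTheory.TwistedPartitionFunction
import HarnessLib

/-!
# The exact diagonal dressing `f(u) = fpBOKernel β Ω W u u / K₁^{(L³β)}(u,u)` is TWIST and COLOUR invariant — the `IsPhys` symmetries of the dressing `W² := f(u)/f(1)`
# (route `FlatTubeReduction`, crux K1 `NearFlatRatioLaw` stmt-QuantumFields-24720; seat `ym-line-ftr-p1` g12; rate twin «ratepack-v3 / frozen fibres»; R2b1 RECORD rung — no summit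
# statement is proved here)

WHY (memo `Cruxes/NearFlatRatioLaw/Lines/ratepack-v3-frozen-g12.md` §5.9 (g)).  The rate twin dresses the record weight by the EXACT diagonal ratio `W² = f(u)/f(1)`; the
`hWphys` field of `AnalyticRatePotInput` asks for its gauge (= colour, on one site) and centre-twist invariance.  Colour: lane A's `fpBOKernel_conj` + `transferKernel_gaugeTransform`.
Twist: a centre twist of the one-site datum `u` multiplies EVERY fine link of direction `k` of the tube configuration `orthoTube u v` by the central `z` (`orthoTube_twist`); such a
direction-wise central multiplication has trivial plaquette coboundary (Literature `plaquetteHolonomy_central_mul`), leaves the time-like coupling and the gauge action unchanged,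
hence the two-slice kernel (`transferKernel_dirMul`) and `fpBOKernel` (`fpBOKernel_twist`); the one-site kernel is the tree's `transferKernel_twist`.
* `dirCoboundary_eq_one`, `wilsonAction_dirMul`, `timeCoupling_dirMul`, `gaugeTransform_dirMul`, ★ `transferKernel_dirMul`, `orthoTube_twist`, ★★ `fpBOKernel_twist`,
  ★★ `diagRatio_twist` (`f(twist_k^z u) = f(u)`), ★ `diagRatio_conj` (`f(cuc⁻¹) = f(u)`).
HONEST FRAMING: symmetry bookkeeping; femto rung R2b1 (RECORD label); not infinite volume, not a gap, not Clay.  No defs, no named facts, no `sorry`.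
-/

set_option autoImplicit false

noncomputable section

open MeasureTheory Filter Topology Real
open scoped BigOperators
open Literature.MathematicalPhysics.QuantumFieldTheory
open Literature.MathematicalPhysics.QuantumLattice

namespace Summit.QuantumFields.YangMills.Theorems.FemtoTransferGap.RateTube

open Summit.QuantumFields.YangMills.Theorems.FemtoTransferGap
open Summit.QuantumFields.YangMills.Theorems.FemtoTransferGap.TwoLattice
open Summit.QuantumFields.YangMills.Theorems.FemtoTransferGap.TwoLattice.ConstTube
open Summit.QuantumFields.YangMills.Theorems.FemtoTransferGap.TwoLattice.Avg
open Summit.QuantumFields.YangMills.Theorems.FemtoTransferGap.TwoLattice.Stiff (LinkSpace)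

variable {L : ℕ} [NeZero L]

/-! ## §1 Direction-wise central multiplication of the fine links -/

omit [NeZero L] in
/-- The link function `c_k^z = (z on direction k, 1 elsewhere)` is centre valued for central `z`. [folklore] -/
theorem dirFun_mem_center (k : Fin 3) {z : SU2} (hz : z ∈ Subgroup.center SU2) (e : Edge 3 L) :
    (fun e : Edge 3 L => if e.2 = k then z else (1 : SU2)) e ∈ Subgroup.center SU2 := by
  dsimp only; split_ifs
  · exact hz
  · exact Subgroup.one_mem _

omit [NeZero L] in
/-- The plaquette coboundary of `c_k^z` is trivial. [folklore] -/
theorem dirCoboundary_eq_one (k : Fin 3) (z : SU2) (x : Site 3 L) (i j : Fin 3) :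
    (fun e : Edge 3 L => if e.2 = k then z else (1 : SU2)) (x, i) * (fun e : Edge 3 L => if e.2 = k then z else (1 : SU2)) (x.shift i, j) *
        ((fun e : Edge 3 L => if e.2 = k then z else (1 : SU2)) (x.shift j, i))⁻¹ * ((fun e : Edge 3 L => if e.2 = k then z else (1 : SU2)) (x, j))⁻¹ = 1 := by
  dsimp only
  by_cases hi : i = k <;> by_cases hj : j = k <;> simp [hi, hj]

/-- The gauge action is invariant under `U ↦ c_k^z·U` for central `z`. [cite: tHooft1979] -/
theorem wilsonAction_dirMul (k : Fin 3) {z : SU2} (hz : z ∈ Subgroup.center SU2) (U : GaugeConfig 3 L SU2) :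
    wilsonAction su2Rep ((fun e : Edge 3 L => if e.2 = k then z else (1 : SU2)) * U) = wilsonAction su2Rep U := by
  unfold wilsonAction
  refine Finset.sum_congr rfl fun p _ => ?_
  rw [plaquetteHolonomy_central_mul (dirFun_mem_center (L := L) k hz), dirCoboundary_eq_one, one_mul]

/-- The time-like coupling is invariant under simultaneous `c_k^z`-multiplication of both slices. [cite: tHooft1979] -/
theorem timeCoupling_dirMul (k : Fin 3) {z : SU2} (hz : z ∈ Subgroup.center SU2) (U V : GaugeConfig 3 L SU2) :
    timeCoupling su2Rep ((fun e : Edge 3 L => if e.2 = k then z else (1 : SU2)) * U) ((fun e : Edge 3 L => if e.2 = k then z else (1 : SU2)) * V) = timeCoupling su2Rep U V := by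
  have hc : ∀ g : SU2, g * z = z * g := fun g => Subgroup.mem_center_iff.1 hz g
  unfold timeCoupling
  refine Finset.sum_congr rfl fun e _ => ?_
  have h : ((fun e : Edge 3 L => if e.2 = k then z else (1 : SU2)) * U) e * (((fun e : Edge 3 L => if e.2 = k then z else (1 : SU2)) * V) e)⁻¹ = U e * (V e)⁻¹ := by
    simp only [Pi.mul_apply]
    split_ifs
    · rw [mul_inv_rev, show z * U e * ((V e)⁻¹ * z⁻¹) = z * (U e * (V e)⁻¹) * z⁻¹ by simp only [mul_assoc], ← hc, mul_inv_cancel_right]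
    · rw [one_mul, one_mul]
  rw [h]

omit [NeZero L] in
/-- Gauge transformations commute with `c_k^z`-multiplication (`z` central). [folklore] -/
theorem gaugeTransform_dirMul (k : Fin 3) {z : SU2} (hz : z ∈ Subgroup.center SU2) (g : Site 3 L → SU2) (V : GaugeConfig 3 L SU2) :
    gaugeTransform g ((fun e : Edge 3 L => if e.2 = k then z else (1 : SU2)) * V) = (fun e : Edge 3 L => if e.2 = k then z else (1 : SU2)) * gaugeTransform g V := by
  have hc : ∀ h : SU2, h * z = z * h := fun h => Subgroup.mem_center_iff.1 hz h
  funext e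
  simp only [gaugeTransform, Pi.mul_apply]
  split_ifs
  · rw [← mul_assoc, hc, mul_assoc, mul_assoc, mul_assoc]
  · rw [one_mul, one_mul]

/-- ★ The two-slice kernel against a gauge copy is invariant under `c_k^z`-multiplication of both slices. [cite: tHooft1979] -/
theorem transferKernel_dirMul (β : ℝ) (k : Fin 3) {z : SU2} (hz : z ∈ Subgroup.center SU2) (U V : GaugeConfig 3 L SU2) (g : Site 3 L → SU2) :
    transferKernel su2Rep β ((fun e : Edge 3 L => if e.2 = k then z else (1 : SU2)) * U) (gaugeTransform g ((fun e : Edge 3 L => if e.2 = k then z else (1 : SU2)) * V)) =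
      transferKernel su2Rep β U (gaugeTransform g V) := by
  rw [gaugeTransform_dirMul k hz]
  unfold transferKernel
  rw [timeCoupling_dirMul k hz, wilsonAction_dirMul k hz, wilsonAction_dirMul k hz]

/-! ## §2 The tube configuration of a twisted slow datum -/

omit [NeZero L] in
/-- ★ `orthoTube (twist_k^z u) v = c_k^z · orthoTube u v` for central `z` (on one site every `k`-link crosses the twist plane). [folklore] -/
theorem orthoTube_twist (k : Fin 3) {z : SU2} (hz : z ∈ Subgroup.center SU2) (u : GaugeConfig 3 1 SU2) (v : Edge 3 L → Fin 3 → ℝ) :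
    orthoTube L (twist k z u) v = (fun e : Edge 3 L => if e.2 = k then z else (1 : SU2)) * orthoTube L u v := by
  have hc : ∀ h : SU2, h * z = z * h := fun h => Subgroup.mem_center_iff.1 hz h
  funext e
  simp only [orthoTube_apply, Pi.mul_apply, twist]
  have h0 : (0 : Site 3 1) k = 0 := Subsingleton.elim _ _
  by_cases he : e.2 = k
  · rw [if_pos ⟨he, h0⟩, if_pos he, ← mul_assoc, hc, mul_assoc]
  · rw [if_neg (fun h => he h.1), if_neg he, one_mul]

/-! ## §3 ★★ Twist and colour invariance of the exact dressing -/

/-- ★★ **`fpBOKernel` is twist invariant**: `fpBOKernel β Ω W (twist_k^z u) (twist_k^z u′) = fpBOKernel β Ω W u u′` for central `z`. [cite: tHooft1979] -/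
theorem fpBOKernel_twist (β : ℝ) (Ω : LinkSpace L → ℝ) (W : (Site 3 L → SU2) → ℝ) (k : Fin 3) {z : SU2} (hz : z ∈ Subgroup.center SU2) (u u' : GaugeConfig 3 1 SU2) :
    fpBOKernel L β Ω W (twist k z u) (twist k z u') = fpBOKernel L β Ω W u u' := by
  unfold fpBOKernel
  simp only [orthoTube_twist k hz, transferKernel_dirMul β k hz]

/-- ★★ **The exact diagonal ratio is twist invariant**: `f(twist_k^z u) = f(u)`, `f(u) = fpBOKernel β Ω W u u / K₁^{(L³β)}(u,u)` (`z` central). [cite: tHooft1979] -/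
theorem diagRatio_twist (β : ℝ) (Ω : LinkSpace L → ℝ) (W : (Site 3 L → SU2) → ℝ) (k : Fin 3) {z : SU2} (hz : z ∈ Subgroup.center SU2) (u : GaugeConfig 3 1 SU2) :
    fpBOKernel L β Ω W (twist k z u) (twist k z u) / transferKernel su2Rep ((L : ℝ) ^ 3 * β) (twist k z u) (twist k z u) =
      fpBOKernel L β Ω W u u / transferKernel su2Rep ((L : ℝ) ^ 3 * β) u u := by
  rw [fpBOKernel_twist β Ω W k hz, transferKernel_twist su2Rep ((L : ℝ) ^ 3 * β) k hz]

/-- ★ **The exact diagonal ratio is colour invariant**: `f(gug⁻¹) = f(u)` for every one-site gauge transformation `g` (colour-blind `Ω`, conjugation-invariant `W`). [folklore] -/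
theorem diagRatio_gaugeTransform (β : ℝ) {Ω : LinkSpace L → ℝ} (hΩm : Measurable Ω) (hΩinv : ∀ (c : SU2) (x : LinkSpace L), Ω (adL L c x) = Ω x)
    {W : (Site 3 L → SU2) → ℝ} (hW : Measurable W) (hWinv : ∀ (c : SU2) (g : Site 3 L → SU2), W (fun x => c * g x * c⁻¹) = W g) (g : Site 3 1 → SU2) (u : GaugeConfig 3 1 SU2) :
    fpBOKernel L β Ω W (gaugeTransform g u) (gaugeTransform g u) / transferKernel su2Rep ((L : ℝ) ^ 3 * β) (gaugeTransform g u) (gaugeTransform g u) =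
      fpBOKernel L β Ω W u u / transferKernel su2Rep ((L : ℝ) ^ 3 * β) u u := by
  rw [gaugeTransform_one_site_eq_const g u, fpBOKernel_conj β hΩm hΩinv hW hWinv (g 0) u u, transferKernel_gaugeTransform]

end Summit.QuantumFields.YangMills.Theorems.FemtoTransferGap.RateTube

end
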